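import Mathlib
import HarnessLib
import Summits.RiemannHypothesis.Statement
import Literature.Analysis.UnboundedOperators.HilbertPolya

/-!
Route: InterimUnbddOp

Carry-over of the interim blast's sorried statements ABOUT RiemannHypothesis from interim trunk
group G07 UnbddOp (Hilbert–Pólya operator route) (Statements/RH/HilbertPolya.lean; harness21 @
d8f2665). Thesis (to be sharpened by the route planner, D-0014e): the equivalences/implications
these 2 statements assert (hilbertPolyaConjecture_iff_riemannHypothesis,
isHilbertPolyaSpectrum_iff_of_riemannHypothesis) hold and, combined, bear on RiemannHypothesis. They
enter as UNSTAMPED statement items: grounder first (most are cited results -> named facts in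
Literature), then refuter, then provers.

UNDER FLOOR: fewer than 2 cruxes remain after retriage (legacy route; D-0019).

Rationale: M5 migration (docs/m5/PLAN.md 2c‴ as amended by D-0014b): no workspace, no THESIS.md; the interim
decl text is in run/m5/workspaces/ for the operator and quoted in each item's --informal.

Novelty: NOVELTY (retriage 2026-08-14; searched: lit search --hybrid "Hilbert-Polya ... equivalent to Riemann
hypothesis"; lit search "Hilbert-Polya operator Riemann zeros self-adjoint" --year-from 2015; lit
frontier / lit bridges RiemannHypothesis). Nearest prior art: the Hilbert–Pólya heuristic itself —
BerryKeating1999SIAM §1 pp. 237–238 ("such frequencies—real numbers—are discrete eigenvalues of a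
self-adjoint (hermitean) operator ... an old idea, going back at least to Hilbert and Polya") and
Connes1999 (absorption-spectrum realisation on the idele class space; trace formula ⇔ RH); the
one-line implication "self-adjoint ⇒ Re ρ = 1/2" is printed e.g. in arXiv:1911.04029 p. 2 and
arXiv:2602.04022 p. 12; recent claimed constructions arXiv:2309.00405 and arXiv:2408.15135 build an
operator from ξ and push self-adjointness/positivity back onto RH. Delta: none in mechanism — this
interim carry-over formalises only the SURROGATE equivalence (∃ real diagonal operator on ℓ²(ℕ,ℂ)
enumerating the non-trivial zeros with multiplicity) ↔ RiemannHypothesis, whose ← direction is the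
tautological diagonal operator (given RH, plus Hardy 1914 for infinitude, Edwards1974 §11.1 p. 224,
now proved in tree). Expected novelty grade: known. Value is infrastructural: a typed interface
(Literature.RH.IsHilbertPolyaSpectrum, LinearPMap.IsHilbertPolyaOperator) against which a genuine
operator-construction thesis can later be stated, staffed and refuted.  [refs: 1911.04029, 2602.04022, 2309.00405, 2408.15135, Connes1999, Edwards1974]

Barriers (technique_class: Hilbert-Polya spectral-realisation-of-zeros reformulation): BARRIERS (technique_class: Hilbert-Polya spectral-realisation-of-zeros reformulation).
- Literature.Barriers.RiemannHypothesis.BerryKeatingOperator (EndresSteiner2010 §2 and Thm. 15.6: xp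
on L²(ℝ_>) has no L² eigenfunctions; every self-adjoint realisation of H_BK or H_BK² on a compact
graph has a LINEAR Weyl law, eventually below N_ζ(T)): does not bite on the surrogate — the route
names no candidate operator; its diagonal operator is built FROM the zeros, so its eigenvalue count
is N_ζ(T) ~ (T/2π) log T by construction. The route escapes only by carrying no mechanism; any later
instantiation by an xp-quantisation falls inside this entry.
- Literature.Barriers.RiemannHypothesis.ScalingSystemCounting (BerryKeating1999SIAM §6 (i); no
power-law counting function N(α) ~ Cα^γ agrees with N_ζ eventually; proved in tree from Riemann–von
Mangoldt): same — the surrogate spectrum has the zeta counting function tautologically; the entry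
constrains which "natural" operators (Laplacians on compact domains or manifolds, D-freedom scaling
systems) could instantiate Literature.RH.HilbertPolyaConjecture, and the route offers none.
- Literature.Barriers.RiemannHypothesis.PseudoLaplacianSpacing (BombieriGarrett2020 Thm. 67, Cor.
68–69: Colin de Verdière pseudo-Laplacians on SL₂(ℤ)\ℌ omit a positive proportion of zeros, on RH +
pair correlation): by that entry's scope caveat (i) it covers only the Bombieri–Garrett
pseudo-Laplacians, "not self-adjoint operators in general, so the Hilbert–Pólya idea as su

sub-problem: RiemannHypothesis · status: open · opened operator:999:2871239 2026-08-13T05:39:11Z · rev 1 · ledger route-RiemannHypothesis-InterimUnbddOp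
GENERATED by the gate from the ledger (D-0016/17). Provers cite these decls: `theorem foo : Summit.RiemannHypothesis.RiemannHypothesis.Theses.InterimUnbddOp.<Decl> := …` in Summits/RiemannHypothesis/RiemannHypothesis/Theorems/<Name>.lean.
-/

namespace Summit.RiemannHypothesis.RiemannHypothesis.Theses.InterimUnbddOp

open scoped BigOperators Topology Manifold Classical MeasureTheory ProbabilityTheory Matrix InnerProductSpace ComplexConjugate ContinuousMap
open Filter Set Function TopologicalSpace MeasureTheory

open Summit Literature.Analysis.UnboundedOperators

/-- item stmt-RiemannHypothesis-0024 · support · rank 2 · open · by operator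
sources: BerryKeating1999SIAM, §1 pp. 237-238 (lit: paper:doi-10-1137-s0036144598347497), Edwards1974, §11.1 p. 224 (Hardy 1914: infinitely many zeros on Re s = 1/2), arXiv:1911.04029, p. 2 (self-adjoint ⇒ Re ρ = 1/2, the → direction), lean: Literature.RH.hardy_infinite_zeros_on_critical_line_holds (Literature/NumberTheory/LFunctions/RHWave0HardyProofs.lean:1692), lean: riemannZetaNontrivialZeros_countable (Literature/NumberTheory/LFunctions/WeilZeroSum.lean:136), lean: HilbertBasis.diagonalPMap (Literature/Analysis/UnboundedOperators/DiagonalOperator.lean:153); Literature.RH.IsHilbertPolyaSpectrum.exists_eq_zetaOrdinateLine_of_mem (HilbertPolya.lean:102)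
The formal Hilbert–Pólya surrogate is equivalent to the Riemann Hypothesis: a Hilbert–Pólya spectrum
forces all non-trivial zeros onto the critical line, and conversely under RH the non-trivial zeros
(countably many, each of finite multiplicity, infinitely many by Hardy) can be enumerated with
multiplicity by `ℕ`, giving a diagonal operator on `ℓ²(ℕ, ℂ)` in the standard basis (elementary;
Berry–Keating 1999, §1). [cite: BerryKeating1999, §1]  [interim: Statements/RH/HilbertPolya.lean:184
`hilbertPolyaConjecture_iff_riemannHypothesis`] -/
def HilbertPolyaConjectureIffRiemannHypothesis : Prop :=
  HilbertPolyaConjecture ↔ RiemannHypothesis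

-- TODO item stmt-RiemannHypothesis-0025 · support · rank 3 · open · by operator — BLOCKED: missing decl(s) riemannZetaNontrivialZeros.indicator; restate via `ledger route edit` once they land:
--   def IsHilbertPolyaSpectrumIffOfRiemannHypothesis : Prop := ∀ (hRH : RiemannHypothesis) {ι : Type*} (γ : ι → ℝ), IsHilbertPolyaSpectrum γ ↔ ∀ t : ℝ, {i | γ i = t}.encard = Set.indicator riemannZetaNontrivialZeros (fun z => (analyticOrderNatAt riemannZeta z : ℕ∞)) (zetaOrdinateLine t)

end Summit.RiemannHypothesis.RiemannHypothesis.Theses.InterimUnbddOp
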